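import Summits.QuantumFields.YangMills.Theorems.NPointIsotropy.Negative.ModelBlindFalse

/-!
# Negative results on `PencilRigidity.NPointIsotropy`, VIII: the junk functional vanishes on every PLANAR-GENERIC
test function — "invariance on generic supports ⇒ invariance on `⁰𝒮` by density" is false model-blind

Eighth file of the standing disprover's analysis of crux stmt-QuantumFields-11686 (refuter, cdisprove, cycle 2);
addressed to the two live idea cards of the crux (`quarter-turn-corner-operator`, `entire-complex-angle-bandlimit`),
both of which close with a step of the form "invariance holds for test functions with generic / frame-split supports,
hence on all of `⁰𝒮` by density and continuity".

Call a configuration `z : Fin 4 → ℝ⁴` PLANAR-DEGENERATE if two of its points have the same projection to the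
`(x₀,x₁)`-plane (`z p 0 = z q 0 ∧ z p 1 = z q 1`, `p ≠ q`) — such a pair has equal rotated times in EVERY planar
frame and for EVERY rotation angle, so these are exactly the configurations the planar-frame continuation arguments
never see — and a test function PLANAR-GENERIC if it vanishes at every planar-degenerate configuration.

* `sp_A_pair_planar`: every configuration in the support of the junk functional `J` (file II) is planar-degenerate.
* `J_eq_zero_of_planar_generic`: `J` kills every planar-generic test function.
* `planar_generic_not_determining`: hence there is a non-zero continuous linear functional on `𝓢((ℝ⁴)⁴)` — `J`
  itself, which satisfies every typed OS clause in all sixteen frames, translations, hypercubic symmetry, the gap and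
  `K = 0` (files II–V) — vanishing on ALL planar-generic test functions and non-zero (indeed not rotation invariant,
  file IV) on the off-diagonal bump tensor `F₀`. So planar-generic test functions do NOT determine a family on `⁰𝒮`
  (functions flat on the coincidence locus need not be limits of functions vanishing at planar-degenerate
  configurations), and the closing density step of both cards must import either the Wilson tie at the order in
  question (the crux) or a continuity clause for `𝔖ₙ` off the coincidence locus (`Disproof.lean` §7b) — with such a
  clause the values on the dense open planar-generic set do determine `𝔖ₙ|⁰𝒮`. At `n = 3` no import is needed if
  all sixteen frames are used (file VII `three_points_frame_separated`); the four planar directions alone do not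
  separate e.g. `(0, e₂, e₀)`.
-/

noncomputable section

-- Mathlib's `SimplexCategory` instance `Fintype (Fin (x.len + 1))` matches `Fintype (Fin 4)` (tree-known workaround,
-- files I–VII).
attribute [-instance] SimplexCategory.instFintypeToTypeOrderHomFinHAddNatLenOfNat

namespace Summit.QuantumFields.YangMills.Theorems.NPointIsotropy.Negative

open scoped BigOperators
open MeasureTheory
open Literature.MathematicalPhysics.QuantumLattice Literature.MathematicalPhysics.AQFT

/-- A configuration of four points of `ℝ⁴` is planar-degenerate if two of its points have the same projection to
the `(x₀,x₁)`-plane. -/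
def IsPlanarDegenerate (z : Fin 4 → E4) : Prop :=
  ∃ p q : Fin 4, p ≠ q ∧ z p 0 = z q 0 ∧ z p 1 = z q 1

/-- Two points differing by an axis vector `c e_m` agree in every coordinate `≠ m`, also after a signed
permutation (in the coordinates `≠ σ m`). -/
theorem sp_coord_eq_of_sub_axis (σ : Equiv.Perm (Fin 4)) (ε : Fin 4 → Bool) {u v : E4} {c : ℝ} {m : Fin 4}
    (h : u - v = c • EuclideanSpace.single m 1) {j : Fin 4} (hj : σ.symm j ≠ m) :
    sp σ ε u j = sp σ ε v j := by
  have hc : u (σ.symm j) = v (σ.symm j) := by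
    have := congrArg (fun w : E4 => w (σ.symm j)) h
    simp only [PiLp.sub_apply, PiLp.smul_apply, PiLp.single_apply, if_neg hj, smul_eq_mul, mul_zero] at this
    linarith
  simp only [sp_apply, hc]

/-- If `σ` sends both `3` and `2` into `{0, 1}` then it sends `0` outside `{0, 1}`. -/
theorem perm_zero_not_planar (σ : Equiv.Perm (Fin 4)) (h3 : σ 3 = 0 ∨ σ 3 = 1) (h2 : σ 2 = 0 ∨ σ 2 = 1) :
    σ 0 ≠ 0 ∧ σ 0 ≠ 1 := by
  have hinj := σ.injective
  have h32 : σ 3 ≠ σ 2 := fun h => absurd (hinj h) (by decide)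
  have h30 : σ 3 ≠ σ 0 := fun h => absurd (hinj h) (by decide)
  have h20 : σ 2 ≠ σ 0 := fun h => absurd (hinj h) (by decide)
  constructor <;> intro h0 <;> rcases h3 with h3 | h3 <;> rcases h2 with h2 | h2 <;> simp_all

/-- **Every configuration charged by `J` is planar-degenerate**: in the pattern `x, x + s e₃, x + t e₂, x + u e₀`
(permuted by `π`, moved by the signed permutation `(σ, ε)`) the pair through the offset `e_m` with `σ m ∉ {0, 1}`
— `m = 3`, else `m = 2`, else `m = 0` — has equal coordinates `0` and `1`. -/
theorem sp_A_pair_planar (σ : Equiv.Perm (Fin 4)) (ε : Fin 4 → Bool) (π : Equiv.Perm (Fin 4)) (y : D7) :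
    IsPlanarDegenerate fun i => sp σ ε (A y (π i)) := by
  -- the pair (π⁻¹ k, π⁻¹ 0) for an offset index k ≠ 0 whose axis e_m is sent outside the plane
  have key : ∀ (k m : Fin 4), k ≠ 0 → (∃ c : ℝ, A y k - A y 0 = c • EuclideanSpace.single m 1) →
      σ m ≠ 0 → σ m ≠ 1 → IsPlanarDegenerate fun i => sp σ ε (A y (π i)) := by
    intro k m hk ⟨c, hc⟩ h0 h1
    refine ⟨π.symm k, π.symm 0, fun h => hk (π.symm.injective h), ?_, ?_⟩
    · simp only [Equiv.apply_symm_apply]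
      exact sp_coord_eq_of_sub_axis σ ε hc (fun h => h0 (by rw [← h, Equiv.apply_symm_apply]))
    · simp only [Equiv.apply_symm_apply]
      exact sp_coord_eq_of_sub_axis σ ε hc (fun h => h1 (by rw [← h, Equiv.apply_symm_apply]))
  by_cases h3 : σ 3 ≠ 0 ∧ σ 3 ≠ 1
  · exact key 1 3 (by decide) ⟨y 4, A_one_sub y⟩ h3.1 h3.2
  by_cases h2 : σ 2 ≠ 0 ∧ σ 2 ≠ 1
  · exact key 2 2 (by decide) ⟨y 5, A_two_sub y⟩ h2.1 h2.2
  have h3' : σ 3 = 0 ∨ σ 3 = 1 := by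
    by_cases h : σ 3 = 0
    · exact Or.inl h
    · exact Or.inr (by by_contra h'; exact h3 ⟨h, h'⟩)
  have h2' : σ 2 = 0 ∨ σ 2 = 1 := by
    by_cases h : σ 2 = 0
    · exact Or.inl h
    · exact Or.inr (by by_contra h'; exact h2 ⟨h, h'⟩)
  obtain ⟨h00, h01⟩ := perm_zero_not_planar σ h3' h2'
  exact key 3 0 (by decide) ⟨y 6, A_three_sub y⟩ h00 h01

/-- **`J` kills every planar-generic test function.** [folklore] -/
theorem J_eq_zero_of_planar_generic (H : SchwartzMap (Fin 4 → E4) ℂ)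
    (hH : ∀ z : Fin 4 → E4, IsPlanarDegenerate z → H z = 0) : J H = 0 := by
  rw [J_apply]
  refine Finset.sum_eq_zero fun g _ => Finset.sum_eq_zero fun π _ => ?_
  have hz : (fun y : D7 => H (fun i => sp g.1 g.2 (A y (π i)))) = fun _ => 0 := by
    funext y
    exact hH _ (sp_A_pair_planar g.1 g.2 π y)
  rw [hz]
  simp

/-- **Planar-generic test functions do not determine a family on `⁰𝒮`.** There is a non-zero continuous linear
functional on `𝓢((ℝ⁴)⁴)` — the junk four-point functional `J`, which satisfies every typed OS clause in all sixteen
frames (files II–V) — that vanishes on every planar-generic test function and is non-zero on an off-diagonal one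
(the bump tensor `F₀` of file IV; moreover `J (R₀ · F₀) = 0 ≠ J F₀`). [folklore] -/
theorem planar_generic_not_determining :
    ∃ T : SchwartzMap (Fin 4 → E4) ℂ →L[ℂ] ℂ,
      (∀ H : SchwartzMap (Fin 4 → E4) ℂ, (∀ z, IsPlanarDegenerate z → H z = 0) → T H = 0) ∧
      ∃ F : SchwartzMap (Fin 4 → E4) ℂ, IsOffDiagonal F ∧ T F ≠ 0 ∧ T (linActMulti R₀ F) = 0 := by
  refine ⟨J, J_eq_zero_of_planar_generic, F₀, F₀_isOffDiagonal, fun h => ?_, J_R₀F₀⟩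
  have hpos := J_F₀_re_pos
  rw [h, Complex.zero_re] at hpos
  exact lt_irrefl _ hpos

end Summit.QuantumFields.YangMills.Theorems.NPointIsotropy.Negative

end
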